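import Literature.Topology.FourManifolds.LevelTranslation
import Literature.Topology.FourManifolds.RegularSlabLevelFlow
import Literature.Topology.FourManifolds.CobordismEndTraces
import HarnessLib

/-!
# The meeting points of `S_R(p)` and `S_L(q)` do not depend on the level, nor on the function

Topic `Literature/Topology/FourManifolds`; a proofs-only file (no definition, no named fact) in
the vocabulary of `HandleSpheres.lean` (`stableSet`, `unstableSet`, `rightHandSphere`,
`leftHandSphere`) and `HCobordismAuxiliaryPair.lean` (`FlowsTo`).

Milnor, *Lectures on the h-cobordism theorem* (1965), §4 (PDF p. 21) and Def. 5.1 (PDF p. 26)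
read the intersection `S_R ∩ S_L'` of the right-hand sphere of `p` and the left-hand sphere of
`p'` in ONE intermediate level `V = f⁻¹(1/2)`, and use freely that *"the trajectories from `p`
meet `V`"* and that each trajectory from `p` to `p'` crosses every intermediate level exactly
once (PDF p. 27: *"the single trajectory `T` from `p` to `p'`"* when `S_R ∩ S_L'` is one point).
In particular the number of points of `S_R(p, c) ∩ S_L(q, c)` is the number of trajectories from
`p` to `q`, the same for every level `c` between `f p` and `f q`, and the same for every other
function `g` admitting the same field `ξ` as a gradient-like field (as after a rearrangement of
the critical values, Thms. 4.1/4.2, which keeps `ξ`).  This file proves the set-theoretic form of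
these remarks that the cancellation theorems consume:

* `FlowsTo.eq_of_apply_eq_of_flowsTo` — a trajectory segment whose two ends lie on one level
  through no critical point is trivial (its ends coincide);
* `exists_mem_handSpheres_inter_flowsTo_or` — every point of `W^u(p) ∩ W^s(q)` is joined by a
  trajectory segment (in one direction or the other) to a point of `S_R(p, c) ∩ S_L(q, c)`, for
  any differentiable `f` non-decreasing along `ξ` and any `c` with `f p < c < f q`;
* `unstableSet_inter_stableSet_eq_empty_of_handSpheres`,
  `handSpheres_inter_eq_empty_of_handSpheres_inter_eq_empty` — hence if `S_R(p, c) ∩ S_L(q, c)`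
  is empty in one such level of one such function, no trajectory runs from `p` to `q`, and the
  intersection is empty in every level of every function;
* `exists_handSpheres_inter_eq_singleton_of_eq_singleton` — and if it is a single point `x₀` in
  one such level of `f`, then in every level `d` of `g` through no critical point of `g`, with
  `g p < d < g q` and `ξ(g) > 0` off the critical points of `g` (`ξ` smooth, Hausdorff manifold,
  boundary allowed), it is again a single point, joined to `x₀` by a trajectory segment.

## References

* J. Milnor, *Lectures on the h-cobordism theorem*, Princeton (1965): Def. 3.9 (PDF p. 16), §4
  (PDF p. 21), Thms. 4.1, 4.2 (PDF pp. 22–23), Def. 5.1, Thm. 5.4 (PDF pp. 26–27).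
  [MilnorHCobordism1965]
-/

open scoped Manifold ContDiff Topology
open Set Function Filter

noncomputable section

namespace Literature.Topology.FourManifolds

section Levels

variable {E : Type*} [NormedAddCommGroup E] [NormedSpace ℝ E] {H : Type*} [TopologicalSpace H]
  {I : ModelWithCorners ℝ E H} {M : Type*} [TopologicalSpace M] [ChartedSpace H M]
  {ξ : Π x : M, TangentSpace I x} {f g : M → ℝ} {p q x : M} {c d : ℝ}

/-- **A trajectory segment with both ends on one regular level is trivial.**  If `ξ(f) > 0` off
the critical points of the differentiable `f`, a segment of `ξ` runs from `a` to `b`,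
`f a = f b`, and the level `f = f a` contains no critical point, then `a = b` (`f` is constant,
hence — the level being regular — strictly increasing along the segment, so the segment has
length `0`). [cite: MilnorHCobordism1965, Def. 3.1 and Lemma 4.7 (PDF pp. 11, 25)] -/
theorem FlowsTo.eq_of_apply_eq_of_flowsTo (hf : MDifferentiable I 𝓘(ℝ, ℝ) f)
    (hpos : ∀ y, ¬ IsMCriticalPt I f y → 0 < mlineDeriv I f y (ξ y)) {a b : M}
    (h : FlowsTo I ξ a b) (hab : f a = f b) (hlev : ∀ w, f w = f a → ¬ IsMCriticalPt I f w) :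
    a = b := by
  obtain ⟨γ, T, hT, hγ, h0, hTb⟩ := h
  rcases hT.eq_or_lt with hT0 | hTpos
  · rw [← h0, ← hTb, ← hT0]
  · exfalso
    have hmono := monotoneOn_comp_of_isMIntegralCurveOn hf
      (mlineDeriv_nonneg_of_pos_of_not_isMCriticalPt hpos) (convex_Icc 0 T) hγ
    have hconst : ∀ t ∈ Icc 0 T, f (γ t) = f a := by
      intro t ht
      refine le_antisymm ?_ ?_
      · have h1 := hmono ht (right_mem_Icc.2 hT) ht.2
        simp only [comp_apply, hTb] at h1
        rwa [← hab] at h1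
      · have h1 := hmono (left_mem_Icc.2 hT) ht ht.1
        simpa only [comp_apply, h0] using h1
    have hsm := strictMonoOn_comp_of_isMIntegralCurveOn hf hpos (convex_Icc 0 T) hγ
      fun t ht => hlev _ (hconst t (interior_subset ht))
    have h2 := hsm (left_mem_Icc.2 hT) (right_mem_Icc.2 hT) hTpos
    simp only [comp_apply, h0, hTb] at h2
    rw [hab] at h2
    exact lt_irrefl _ h2

/-- **Every trajectory from `p` to `q` meets every intermediate level**: if `f` is differentiable
and non-decreasing along `ξ`, `f p < c < f q`, and `x` lies on a trajectory coming from `p` and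
on one going to `q`, then a trajectory segment joins `x` (forwards if `f x ≤ c`, backwards if
`c ≤ f x`) to a point of `S_R(p, c) ∩ S_L(q, c)`. [cite: MilnorHCobordism1965, §4 (PDF p. 21), Def. 3.9 (PDF p. 16)] -/
theorem exists_mem_handSpheres_inter_flowsTo_or (hf : MDifferentiable I 𝓘(ℝ, ℝ) f)
    (hpc : f p < c) (hcq : c < f q) (hx : x ∈ unstableSet I ξ p ∩ stableSet I ξ q) :
    ∃ z ∈ rightHandSphere I f ξ p c ∩ leftHandSphere I f ξ q c,
      FlowsTo I ξ x z ∨ FlowsTo I ξ z x := by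
  rcases le_total (f x) c with hxc | hcx
  · obtain ⟨z, hzc, hxz, hzs⟩ := exists_flowsTo_of_mem_stableSet hf hx.2 hxc hcq
    exact ⟨z, ⟨⟨hxz.mem_unstableSet_right hx.1, hzc⟩, ⟨hzs, hzc⟩⟩, Or.inl hxz⟩
  · obtain ⟨z, hzc, hzx, hzu⟩ := exists_flowsTo_of_mem_unstableSet hf hx.1 hcx hpc
    exact ⟨z, ⟨⟨hzu, hzc⟩, ⟨hzx.mem_stableSet hx.2, hzc⟩⟩, Or.inr hzx⟩

/-- **No meeting point in one level means no trajectory from `p` to `q`**: if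
`S_R(p, c) ∩ S_L(q, c) = ∅` for some differentiable `f` non-decreasing along `ξ` and some `c`
with `f p < c < f q`, then `W^u(p) ∩ W^s(q) = ∅`. [cite: MilnorHCobordism1965, §4 (PDF p. 21)] -/
theorem unstableSet_inter_stableSet_eq_empty_of_handSpheres (hf : MDifferentiable I 𝓘(ℝ, ℝ) f)
    (hpc : f p < c) (hcq : c < f q)
    (h : rightHandSphere I f ξ p c ∩ leftHandSphere I f ξ q c = ∅) :
    unstableSet I ξ p ∩ stableSet I ξ q = ∅ := by
  refine eq_empty_iff_forall_notMem.2 fun x hx => ?_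
  obtain ⟨z, hz, -⟩ := exists_mem_handSpheres_inter_flowsTo_or hf hpc hcq hx
  rw [h] at hz
  exact hz

/-- **… and then no meeting point in any level of any function**: under the same hypothesis,
`S_R(p, d) ∩ S_L(q, d) = ∅` for EVERY function `g` and EVERY `d` (both spheres taken for the
same field `ξ`). [cite: MilnorHCobordism1965, §4 (PDF p. 21)] -/
theorem handSpheres_inter_eq_empty_of_handSpheres_inter_eq_empty
    (hf : MDifferentiable I 𝓘(ℝ, ℝ) f) (hpc : f p < c) (hcq : c < f q)
    (h : rightHandSphere I f ξ p c ∩ leftHandSphere I f ξ q c = ∅) (g : M → ℝ) (d : ℝ) :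
    rightHandSphere I g ξ p d ∩ leftHandSphere I g ξ q d = ∅ := by
  refine eq_empty_iff_forall_notMem.2 fun y hy => ?_
  have h0 := unstableSet_inter_stableSet_eq_empty_of_handSpheres hf hpc hcq h
  exact (eq_empty_iff_forall_notMem.1 h0) y ⟨hy.1.1, hy.2.1⟩

variable [IsManifold I ∞ M] [T2Space M]

/-- **A single meeting point in one level gives a single meeting point in every regular level of
every function with the same gradient-like field.**  Let `ξ` be a smooth field on the Hausdorff
manifold `M` (boundary allowed); `f`, `g` differentiable, `f` non-decreasing along `ξ` and
`ξ(g) > 0` off the critical points of `g`; `f p < c < f q` and `g p < d < g q`, the level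
`g = d` containing no critical point of `g`.  If `S_R(p, c) ∩ S_L(q, c)` (for `f`) is the single
point `x₀`, then `S_R(p, d) ∩ S_L(q, d)` (for `g`) is a single point `y₀`, and a trajectory
segment joins `x₀` to `y₀` or `y₀` to `x₀`.  (Every meeting point on the `g`-level lies on a
trajectory through the unique meeting point `x₀` of the `f`-level, and a trajectory crosses the
regular level `g = d` only once.)  This is the form in which the hypothesis *"`S_R` and `S_L'`
intersect in a single point"* of the First Cancellation Theorem survives a rearrangement of the
critical values (Thms. 4.1/4.2 keep `ξ`). [cite: MilnorHCobordism1965, Def. 5.1, Thm. 5.4 (PDF pp. 26–27), Thms. 4.1, 4.2 (PDF pp. 22–23)] -/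
theorem exists_handSpheres_inter_eq_singleton_of_eq_singleton
    (hv : ContMDiff I I.tangent ∞ (fun w => (⟨w, ξ w⟩ : TangentBundle I M)))
    (hf : MDifferentiable I 𝓘(ℝ, ℝ) f) (hg : MDifferentiable I 𝓘(ℝ, ℝ) g)
    (hgpos : ∀ y, ¬ IsMCriticalPt I g y → 0 < mlineDeriv I g y (ξ y))
    (hpc : f p < c) (hcq : c < f q) (hpd : g p < d) (hdq : d < g q)
    (hreg : ∀ w, g w = d → ¬ IsMCriticalPt I g w) {x₀ : M}
    (h : rightHandSphere I f ξ p c ∩ leftHandSphere I f ξ q c = {x₀}) :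
    ∃ y₀, rightHandSphere I g ξ p d ∩ leftHandSphere I g ξ q d = {y₀} ∧
      (FlowsTo I ξ x₀ y₀ ∨ FlowsTo I ξ y₀ x₀) := by
  have hx₀ : x₀ ∈ rightHandSphere I f ξ p c ∩ leftHandSphere I f ξ q c := by
    rw [h]; exact mem_singleton x₀
  obtain ⟨y₀, hy₀, hflow₀⟩ :=
    exists_mem_handSpheres_inter_flowsTo_or (f := g) hg hpd hdq ⟨hx₀.1.1, hx₀.2.1⟩
  refine ⟨y₀, eq_singleton_iff_unique_mem.2 ⟨hy₀, fun y hy => ?_⟩, hflow₀⟩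
  obtain ⟨z, hz, hflow⟩ :=
    exists_mem_handSpheres_inter_flowsTo_or (f := f) hf hpc hcq ⟨hy.1.1, hy.2.1⟩
  rw [h, mem_singleton_iff] at hz
  subst hz
  have hyd : g y = d := hy.1.2
  have hy₀d : g y₀ = d := hy₀.1.2
  have hlev : ∀ w, g w = g y → ¬ IsMCriticalPt I g w := fun w hw => hreg w (hw.trans hyd)
  have hlev₀ : ∀ w, g w = g y₀ → ¬ IsMCriticalPt I g w := fun w hw => hreg w (hw.trans hy₀d)
  rcases hflow with hyz | hzy
  · rcases hflow₀ with hzy₀ | hy₀z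
    · -- `y → x₀ → y₀`: a segment inside the regular level `d`
      exact FlowsTo.eq_of_apply_eq_of_flowsTo hg hgpos (hyz.trans hzy₀) (hyd.trans hy₀d.symm)
        hlev
    · -- `y → x₀ ← y₀`: two starts on the level `d` with a common end
      exact FlowsTo.eq_of_apply_eq' hv hg hgpos hyz hy₀z (hyd.trans hy₀d.symm) hlev
  · rcases hflow₀ with hzy₀ | hy₀z
    · -- `y ← x₀ → y₀`: one start, two ends on the level `d`
      exact FlowsTo.eq_of_apply_eq hv hg hgpos hzy hzy₀ (hyd.trans hy₀d.symm) hlev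
    · -- `y₀ → x₀ → y`
      exact (FlowsTo.eq_of_apply_eq_of_flowsTo hg hgpos (hy₀z.trans hzy) (hy₀d.trans hyd.symm)
        hlev₀).symm

/-- The same with `g = f`: **the single meeting point in one level `c` gives a single meeting
point in every other regular level `d` between `f p` and `f q`** (`ξ` smooth with `ξ(f) > 0`
off the critical points). [cite: MilnorHCobordism1965, §4 (PDF p. 21), Def. 5.1 (PDF p. 26)] -/
theorem exists_handSpheres_inter_eq_singleton_of_eq_singleton_level
    (hv : ContMDiff I I.tangent ∞ (fun w => (⟨w, ξ w⟩ : TangentBundle I M)))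
    (hf : MDifferentiable I 𝓘(ℝ, ℝ) f)
    (hpos : ∀ y, ¬ IsMCriticalPt I f y → 0 < mlineDeriv I f y (ξ y))
    (hpc : f p < c) (hcq : c < f q) (hpd : f p < d) (hdq : d < f q)
    (hreg : ∀ w, f w = d → ¬ IsMCriticalPt I f w) {x₀ : M}
    (h : rightHandSphere I f ξ p c ∩ leftHandSphere I f ξ q c = {x₀}) :
    ∃ y₀, rightHandSphere I f ξ p d ∩ leftHandSphere I f ξ q d = {y₀} ∧
      (FlowsTo I ξ x₀ y₀ ∨ FlowsTo I ξ y₀ x₀) :=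
  exists_handSpheres_inter_eq_singleton_of_eq_singleton hv hf hf hpos hpc hcq hpd hdq hreg h

end Levels

end Literature.Topology.FourManifolds

end
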